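import Literature.Topology.FourManifolds.ConcordanceStraighteningBoth
import Literature.Topology.FourManifolds.HomotopyBallSliceProofs
import Literature.Topology.FourManifolds.NeckCapping
import HarnessLib

/-!
# A knot concordant to the unknot is smoothly slice (capping off a concordance)

Topic `Literature/Topology/FourManifolds`; first half of the discharge of the named fact
`Literature.Topology.FourManifolds.Knot.isSmoothlySlice_iff_isConcordant_unknot` of `SliceRibbon.lean`
(R. H. Fox, J. W. Milnor, *Singularities of 2-spheres in 4-space and cobordism of knots*, Osaka J.
Math. 3 (1966) 257–267, §3: "the identity element of this group is the class `<0>` of slice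
knots" together with Theorem 3, p. 265: two knot types are cobordant iff they cobound a locally
flat annulus in the slab `0 ≤ x₄ ≤ 1`; smooth version: C. Livingston, *A survey of classical knot
concordance* (2005), §1 and §2.1). Proved here, with no named facts:

* `Literature.Topology.FourManifolds.Knot.IsConcordant.isSmoothlySlice_of_unknot`:
  if `K` is concordant to the unknot (`Knot.IsConcordant K unknot`), then `K` is smoothly slice
  (`Knot.IsSmoothlySlice K`).

## Proof (Fox–Milnor's cone `w k₁` over the trivial end, made smooth)

By the two-ended straightening of the tree (`Knot.IsConcordance.exists_conical`,
`ConcordanceStraighteningBoth.lean`; Kosinski (1993), II (2.8.2)) the concordance may be taken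
*conical beyond the seams*: `f (x, t) = t • K x` for all `t ≤ 1 + δ` and `f (x, t) = t • U x` for
all `t ≥ 2 - δ`, `U = unknot` the standard great circle `(x₀, x₁) ↦ (x₀, x₁, 0, 0)`. The outer cone
`t • U x` is the flat plane `flatDisc (t • x)`. Read the annulus from the outside in: the map
`capDisc f : ℝ² → ℝ⁴`, `y ↦ ι (f (y/‖y‖, 1/‖y‖))` with `ι (z) = z / ‖z‖²` the inversion in the
unit sphere (`(1/2) • shellInversion`, `SliceGenusConcordance.lean`), is

* the flat disc `flatDisc y` on the ball `‖y‖ < 1/(2 - δ)` (the inverted outer cone; in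
  particular at `y = 0`, where the polar formula is junk-free because `f (·, 0) = 0`),
* the inverted annulus on `1/(2 - δ) ≤ ‖y‖ ≤ 1`, ending with `capDisc f x = K x` on `‖x‖ = 1`.

It is `C^∞` (two smooth local formulas), injective on `𝔻²` (injectivity of `f` on the annulus,
of the cone in `t`, and of the inversion), an immersion on `𝔻²` (chain rule: the polar map
`y ↦ (y/‖y‖, 1/‖y‖)` has the smooth left inverse `(x, t) ↦ t⁻¹ • x`, `f` is an immersion on the
annulus, the inversion is a local diffeomorphism), and maps the open disc into the open ball
(shell condition). This is a *proper* slice disc (`Knot.IsProperDisc`, `HomotopyBallSliceProofs.lean`),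
and the tree's neatening theorem `Knot.isSmoothlySlice_of_isProperDisc_holds` (Hirsch (1976),
Ch. 2 Thm. 1.4 made quantitative) finishes. (In fact `capDisc f` is already neat, being the cone
`‖y‖ • K (y/‖y‖)` near the unit circle, but the neatening theorem makes this check unnecessary.)

## References

* R. H. Fox, J. W. Milnor, Osaka J. Math. 3 (1966) 257–267, §3, Thm. 3 (p. 265). [FoxMilnor1966]
* C. Livingston, *A survey of classical knot concordance*, Handbook of knot theory (2005), §1,
  §2.1. [Livingston2005]
* A. A. Kosinski, *Differential Manifolds* (1993), II (2.8.2) (collars adapted to a neat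
  submanifold). [Kosinski1993]

## Design notes

No named facts, no `sorry`, no instances (two `Fact (finrank …)` lemmas of the tree are used as
*local* instances, as in `SliceRibbonConcordanceProofs.lean`). Local notation `𝔼 n`, `𝕊 n`, `𝔻²`
as in `SliceRibbon.lean`.
-/

open scoped Manifold ContDiff Topology
open Function Set Metric

noncomputable section

namespace Literature.Topology.FourManifolds

attribute [local instance] fact_finrank_euclideanSpace_two fact_finrank_euclideanSpace_four

/-- Local notation: `𝔼 n` is the model Euclidean space `EuclideanSpace ℝ (Fin n)`. -/
local notation "𝔼 " n:arg => EuclideanSpace ℝ (Fin n)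

/-- Local notation: `𝕊 n` is the unit sphere in `EuclideanSpace ℝ (Fin (n + 1))`. -/
local notation "𝕊 " n:arg => (Metric.sphere (0 : EuclideanSpace ℝ (Fin (n + 1))) 1)

/-- Local notation: `𝔻²` is the closed unit disc in `ℝ²`. -/
local notation "𝔻²" => Metric.closedBall (0 : EuclideanSpace ℝ (Fin 2)) 1

namespace Knot

namespace CapOff

open IsConcordance

/-! ### The inversion in the unit sphere -/

/-- The **inversion in the unit sphere** of `ℝ⁴`, `z ↦ z / ‖z‖²` (for `‖z‖ ≥ 1/2`; cut off to
`0` near the origin so as to be `C^∞` on `ℝ⁴`): one half of the tree's `shellInversion`. It fixes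
`𝕊³` pointwise and exchanges the inside and the outside of the unit ball. [folklore] -/
def unitInversion (z : 𝔼 4) : 𝔼 4 :=
  (1 / 2 : ℝ) • shellInversion z

/-- `unitInversion` is `C^∞`. [folklore] -/
theorem contDiff_unitInversion : ContDiff ℝ ∞ unitInversion := by
  unfold unitInversion
  exact contDiff_shellInversion.const_smul _

/-- Away from the cut-off, `unitInversion z = ‖z‖⁻² • z`. [folklore] -/
theorem unitInversion_eq {z : 𝔼 4} (hz : 1 / 2 ≤ ‖z‖) :
    unitInversion z = (‖z‖ ^ 2)⁻¹ • z := by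
  unfold unitInversion
  rw [shellInversion_eq hz, smul_smul]
  congr 1
  ring

/-- `unitInversion 0 = 0` (the cut-off value). [folklore] -/
theorem unitInversion_zero : unitInversion 0 = 0 := by
  simp [unitInversion, shellInversion]

/-- `‖unitInversion z‖ = ‖z‖⁻¹` away from the cut-off. [folklore] -/
theorem norm_unitInversion {z : 𝔼 4} (hz : 1 / 2 ≤ ‖z‖) : ‖unitInversion z‖ = ‖z‖⁻¹ := by
  have hz0 : ‖z‖ ≠ 0 := by linarith
  rw [unitInversion_eq hz, norm_smul, norm_inv, norm_pow, Real.norm_of_nonneg (norm_nonneg _)]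
  field_simp

/-- `unitInversion` fixes the unit sphere pointwise. [folklore] -/
theorem unitInversion_of_norm_eq_one {z : 𝔼 4} (hz : ‖z‖ = 1) : unitInversion z = z := by
  rw [unitInversion_eq (by rw [hz]; norm_num), hz]
  simp

/-- `unitInversion` is injective away from the cut-off. [folklore] -/
theorem unitInversion_injOn : InjOn unitInversion {z : 𝔼 4 | 1 / 2 ≤ ‖z‖} := by
  intro z hz z' hz' h
  have hn : ‖z‖ = ‖z'‖ := by
    have := congrArg (fun w ↦ ‖w‖) h
    simp only [norm_unitInversion hz, norm_unitInversion hz'] at this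
    exact inv_injective this
  rw [unitInversion_eq hz, unitInversion_eq hz', hn] at h
  have hne : (‖z'‖ ^ 2)⁻¹ ≠ 0 := by
    have : (0 : ℝ) < ‖z'‖ := by linarith [show (1 : ℝ) / 2 ≤ ‖z'‖ from hz']
    positivity
  exact smul_right_injective (𝔼 4) hne h

/-- The derivative of `unitInversion` at a point of the shell `1 ≤ ‖z‖ ≤ 2` is injective. [folklore] -/
theorem fderiv_unitInversion_injective {z : 𝔼 4} (hz : 1 ≤ ‖z‖) (hz' : ‖z‖ ≤ 2) :
    Injective (fderiv ℝ unitInversion z) := by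
  have hd : DifferentiableAt ℝ shellInversion z :=
    contDiff_shellInversion.contDiffAt.differentiableAt (by simp)
  have hfd : fderiv ℝ unitInversion z = (1 / 2 : ℝ) • fderiv ℝ shellInversion z := by
    unfold unitInversion
    exact fderiv_const_smul hd (1 / 2 : ℝ)
  intro v w h
  simp only [hfd, FunLike.coe_smul, Pi.smul_apply] at h
  exact fderiv_shellInversion_injective hz hz'
    (smul_right_injective (𝔼 4) (by norm_num : (1 / 2 : ℝ) ≠ 0) h)

/-! ### Polar reading of the disc -/

/-- A base point of `𝕊 1` (the junk direction of the origin). [folklore] -/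
def basePt : 𝕊 1 := circlePoint 0

/-- The **polar argument** `y ↦ (y / ‖y‖, 1 / ‖y‖)` of the capped disc: the point `y ≠ 0` of the
plane is read as the point of the annulus `𝕊 1 × ℝ` with direction `y / ‖y‖` and time `1 / ‖y‖`
(the unit circle is time `1`, the circle of radius `1/2` is time `2`); junk `(basePt, 0)` at the
origin. [folklore] -/
def capArg (y : 𝔼 2) : (𝕊 1) × ℝ :=
  (unitDir basePt y, ‖y‖⁻¹)

/-- The smooth left inverse `(x, t) ↦ t⁻¹ • x` of `capArg`. [folklore] -/
def capInv (q : (𝕊 1) × ℝ) : 𝔼 2 :=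
  q.2⁻¹ • ((q.1 : 𝕊 1) : 𝔼 2)

/-- Second component of `capArg`. [folklore] -/
@[simp]
theorem capArg_snd (y : 𝔼 2) : (capArg y).2 = ‖y‖⁻¹ := rfl

/-- First component of `capArg` at a nonzero point. [folklore] -/
theorem coe_capArg_fst {y : 𝔼 2} (hy : y ≠ 0) : ((capArg y).1 : 𝔼 2) = ‖y‖⁻¹ • y :=
  coe_unitDir_of_ne basePt hy

/-- `capArg 0 = (basePt, 0)`. [folklore] -/
theorem capArg_zero : capArg 0 = (basePt, 0) := by
  unfold capArg unitDir
  simp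

/-- `capInv ∘ capArg = id` off the origin. [folklore] -/
theorem capInv_capArg {y : 𝔼 2} (hy : y ≠ 0) : capInv (capArg y) = y := by
  have hn : ‖y‖ ≠ 0 := norm_ne_zero_iff.2 hy
  unfold capInv
  rw [coe_capArg_fst hy, capArg_snd, inv_inv, smul_smul, mul_inv_cancel₀ hn, one_smul]

/-- `capArg` is injective off the origin. [folklore] -/
theorem capArg_injOn : InjOn capArg {0}ᶜ := fun y hy y' hy' h ↦ by
  rw [← capInv_capArg (show y ≠ 0 from hy), ← capInv_capArg (show y' ≠ 0 from hy'), h]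

/-- On the unit circle, `capArg x = (x, 1)`. [folklore] -/
theorem capArg_coe_sphere (x : 𝕊 1) : capArg (x : 𝔼 2) = (x, 1) := by
  have hx : ‖(x : 𝔼 2)‖ = 1 := norm_eq_of_mem_sphere x
  have hx0 : (x : 𝔼 2) ≠ 0 := ne_zero_of_mem_unit_sphere x
  refine Prod.ext (Subtype.ext ?_) ?_
  · rw [coe_capArg_fst hx0, hx, inv_one, one_smul]
  · rw [capArg_snd, hx, inv_one]

/-- `capArg` is `C^∞` off the origin. [folklore] -/
theorem contMDiffOn_capArg :
    ContMDiffOn 𝓘(ℝ, 𝔼 2) ((𝓡 1).prod 𝓘(ℝ, ℝ)) ∞ capArg {0}ᶜ := by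
  have h : ContMDiffOn 𝓘(ℝ, 𝔼 2) 𝓘(ℝ, ℝ) ∞ (fun y : 𝔼 2 ↦ ‖y‖⁻¹) {0}ᶜ := by
    rw [contMDiffOn_iff_contDiffOn]
    exact fun y hy ↦ ((contDiffAt_norm ℝ hy).inv (norm_ne_zero_iff.2 hy)).contDiffWithinAt
  exact (contMDiffOn_unitDir basePt).prodMk h

/-- `capArg` is `C^∞` at every nonzero point. [folklore] -/
theorem contMDiffAt_capArg {y : 𝔼 2} (hy : y ≠ 0) :
    ContMDiffAt 𝓘(ℝ, 𝔼 2) ((𝓡 1).prod 𝓘(ℝ, ℝ)) ∞ capArg y :=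
  (contMDiffOn_capArg y hy).contMDiffAt (isOpen_compl_singleton.mem_nhds hy)

/-- `capInv` is `C^∞` at every point of nonzero time. [folklore] -/
theorem contMDiffAt_capInv {q : (𝕊 1) × ℝ} (hq : q.2 ≠ 0) :
    ContMDiffAt ((𝓡 1).prod 𝓘(ℝ, ℝ)) 𝓘(ℝ, 𝔼 2) ∞ capInv q := by
  have h1 : ContMDiffAt ((𝓡 1).prod 𝓘(ℝ, ℝ)) 𝓘(ℝ, ℝ) ∞ (fun p : (𝕊 1) × ℝ ↦ p.2⁻¹) q :=
    ((contDiffAt_inv ℝ hq).contMDiffAt).comp q contMDiffAt_snd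
  have h2 : ContMDiffAt ((𝓡 1).prod 𝓘(ℝ, ℝ)) 𝓘(ℝ, 𝔼 2) ∞
      (fun p : (𝕊 1) × ℝ ↦ ((p.1 : 𝕊 1) : 𝔼 2)) q :=
    ((contMDiff_coe_sphere (n := 1)).comp contMDiff_fst).contMDiffAt
  exact h1.smul h2

/-- The differential of `capArg` at a nonzero point is injective (chain rule on
`capInv ∘ capArg = id` near the point). [folklore] -/
theorem mfderiv_capArg_injective {y : 𝔼 2} (hy : y ≠ 0) :
    Injective (mfderiv 𝓘(ℝ, 𝔼 2) ((𝓡 1).prod 𝓘(ℝ, ℝ)) capArg y) := by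
  have hdA : MDifferentiableAt 𝓘(ℝ, 𝔼 2) ((𝓡 1).prod 𝓘(ℝ, ℝ)) capArg y :=
    (contMDiffAt_capArg hy).mdifferentiableAt (by simp)
  have hq : (capArg y).2 ≠ 0 := by
    rw [capArg_snd]
    exact inv_ne_zero (norm_ne_zero_iff.2 hy)
  have hdI : MDifferentiableAt ((𝓡 1).prod 𝓘(ℝ, ℝ)) 𝓘(ℝ, 𝔼 2) capInv (capArg y) :=
    (contMDiffAt_capInv hq).mdifferentiableAt (by simp)
  have hev : capInv ∘ capArg =ᶠ[𝓝 y] id := by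
    filter_upwards [isOpen_compl_singleton.mem_nhds hy] with y' hy'
    exact capInv_capArg hy'
  have key : (mfderiv ((𝓡 1).prod 𝓘(ℝ, ℝ)) 𝓘(ℝ, 𝔼 2) capInv (capArg y)).comp
      (mfderiv 𝓘(ℝ, 𝔼 2) ((𝓡 1).prod 𝓘(ℝ, ℝ)) capArg y) =
      ContinuousLinearMap.id ℝ (TangentSpace 𝓘(ℝ, 𝔼 2) y) := by
    rw [← mfderiv_comp y hdI hdA, hev.mfderiv_eq, mfderiv_id]
  intro v w h
  have h' := congrArg (mfderiv ((𝓡 1).prod 𝓘(ℝ, ℝ)) 𝓘(ℝ, 𝔼 2) capInv (capArg y)) h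
  rwa [← ContinuousLinearMap.comp_apply, ← ContinuousLinearMap.comp_apply, key] at h'

/-! ### The capped disc -/

/-- The **capped disc** of an annulus `f : 𝕊 1 × ℝ → ℝ⁴`: `y ↦ ι (f (y / ‖y‖, 1 / ‖y‖))`, the
annulus read from the outside in and inverted in the unit sphere. For a concordance from `K` to
the unknot which is conical beyond the seams this is a proper slice disc for `K`
(`isProperDisc_capDisc`): Fox–Milnor's cone over the trivial end of the annulus.
[cite: FoxMilnor1966, §3 Thm. 3] -/
def capDisc (f : (𝕊 1) × ℝ → 𝔼 4) (y : 𝔼 2) : 𝔼 4 :=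
  unitInversion (f (capArg y))

variable [SphereEmbedding.SmoothnessFacts] {K : Knot} {f : (𝕊 1) × ℝ → 𝔼 4} {δ : ℝ}

/-- The outer cone over the unknot, read through `capArg`, is the flat disc scaled by `‖y‖⁻²`.
[folklore] -/
theorem cone_unknot_capArg {y : 𝔼 2} (hy : y ≠ 0) :
    (capArg y).2 • ((unknot (capArg y).1 : 𝕊 3) : 𝔼 4) = (‖y‖⁻¹ * ‖y‖⁻¹) • flatDisc y := by
  rw [← flatDisc_coe_sphere, coe_capArg_fst hy, capArg_snd, map_smul, smul_smul]

section Conical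

variable (hhigh : ∀ (x : 𝕊 1) (t : ℝ), 2 - δ ≤ t → f (x, t) = t • ((unknot x : 𝕊 3) : 𝔼 4))
include hhigh

/-- In the outer-cone regime `‖y‖⁻¹ ≥ 2 - δ`, `f (capArg y) = ‖y‖⁻² • flatDisc y`. [folklore] -/
theorem apply_capArg_of_le {y : 𝔼 2} (hy : y ≠ 0) (h : 2 - δ ≤ ‖y‖⁻¹) :
    f (capArg y) = (‖y‖⁻¹ * ‖y‖⁻¹) • flatDisc y := by
  rw [← cone_unknot_capArg hy, capArg_snd, ← hhigh _ _ h]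
  rfl

/-- In the outer-cone regime, `‖f (capArg y)‖ = ‖y‖⁻¹`. [folklore] -/
theorem norm_apply_capArg_of_le {y : 𝔼 2} (hy : y ≠ 0) (h : 2 - δ ≤ ‖y‖⁻¹) :
    ‖f (capArg y)‖ = ‖y‖⁻¹ := by
  have hn : 0 < ‖y‖ := norm_pos_iff.2 hy
  rw [apply_capArg_of_le hhigh hy h, norm_smul, norm_flatDisc, Real.norm_of_nonneg (by positivity)]
  field_simp

/-- In the outer-cone regime (`δ ≤ 1/4`), the capped disc is the flat disc. [folklore] -/
theorem capDisc_of_le (hδ : δ ≤ 1 / 4) {y : 𝔼 2} (hy : y ≠ 0) (h : 2 - δ ≤ ‖y‖⁻¹) :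
    capDisc f y = flatDisc y := by
  have hn : 0 < ‖y‖ := norm_pos_iff.2 hy
  have hnorm := norm_apply_capArg_of_le hhigh hy h
  unfold capDisc
  rw [unitInversion_eq (by rw [hnorm]; linarith), hnorm, apply_capArg_of_le hhigh hy h, smul_smul]
  conv_rhs => rw [← one_smul ℝ (flatDisc y)]
  congr 1
  field_simp

end Conical

/-- **The capped disc of a conical concordance to the unknot is a proper slice disc.**
[cite: FoxMilnor1966, §3 Thm. 3] -/
theorem isProperDisc_capDisc (hf : IsConcordance K unknot f) (hδ : 0 < δ) (hδ4 : δ ≤ 1 / 4)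
    (hlow : ∀ (x : 𝕊 1) (t : ℝ), t ≤ 1 + δ → f (x, t) = t • ((K x : 𝕊 3) : 𝔼 4))
    (hhigh : ∀ (x : 𝕊 1) (t : ℝ), 2 - δ ≤ t → f (x, t) = t • ((unknot x : 𝕊 3) : 𝔼 4)) :
    K.IsProperDisc (capDisc f) := by
  have hnorm := norm_mem_Icc hf
  obtain ⟨hsmooth, hinj, himm, hshell, -, hK, -⟩ := hf
  -- the radius `1/(2 - δ)` of the flat zone
  have h2δ : (0 : ℝ) < 2 - δ := by linarith
  have hflat : ∀ y : 𝔼 2, ‖y‖ < 1 / (2 - δ) → capDisc f y = flatDisc y := by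
    intro y hy
    by_cases hy0 : y = 0
    · subst hy0
      rw [capDisc, capArg_zero, hlow basePt 0 (by linarith), zero_smul, unitInversion_zero, map_zero]
    · have hn : 0 < ‖y‖ := norm_pos_iff.2 hy0
      refine capDisc_of_le hhigh hδ4 hy0 ?_
      rw [lt_div_iff₀ h2δ] at hy
      rw [le_inv_comm₀ h2δ hn, inv_eq_one_div]
      exact (le_div_iff₀ h2δ).2 hy.le
  -- times and norms on the annular zone `1/(2 - δ) ≤ ‖y‖ ≤ 1`
  have htime : ∀ y : 𝔼 2, 1 / (2 - δ) ≤ ‖y‖ → ‖y‖ ≤ 1 → ‖y‖⁻¹ ∈ Icc (1 : ℝ) 2 := by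
    intro y h1 h2
    have hn : 0 < ‖y‖ := lt_of_lt_of_le (by positivity) h1
    refine ⟨one_le_inv_iff₀.2 ⟨hn, h2⟩, ?_⟩
    rw [inv_le_comm₀ hn two_pos]
    calc (2 : ℝ)⁻¹ ≤ 1 / (2 - δ) := by rw [inv_eq_one_div]; gcongr; linarith
      _ ≤ ‖y‖ := h1
  have hmemA : ∀ y : 𝔼 2, 1 / (2 - δ) ≤ ‖y‖ → ‖y‖ ≤ 1 → capArg y ∈ univ ×ˢ Icc (1 : ℝ) 2 :=
    fun y h1 h2 ↦ ⟨mem_univ _, htime y h1 h2⟩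
  have hne : ∀ y : 𝔼 2, 1 / (2 - δ) ≤ ‖y‖ → y ≠ 0 := fun y h1 ↦
    norm_pos_iff.1 (lt_of_lt_of_le (by positivity) h1)
  -- norm of `f (capArg y)` for every `y ∈ 𝔻² ∖ 0`
  have hnorm1 : ∀ y : 𝔼 2, y ≠ 0 → ‖y‖ ≤ 1 → 1 ≤ ‖f (capArg y)‖ := by
    intro y hy0 hy1
    rcases le_or_gt (2 - δ) ‖y‖⁻¹ with h | h
    · rw [norm_apply_capArg_of_le hhigh hy0 h]
      linarith
    · have hn : 0 < ‖y‖ := norm_pos_iff.2 hy0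
      exact (hnorm _ ⟨one_le_inv_iff₀.2 ⟨hn, hy1⟩, by linarith⟩).1
  -- smoothness off the origin
  have hsmooth0 : ContDiffOn ℝ ∞ (capDisc f) {0}ᶜ := by
    have h1 : ContMDiffOn 𝓘(ℝ, 𝔼 2) 𝓘(ℝ, 𝔼 4) ∞ (f ∘ capArg) {0}ᶜ :=
      hsmooth.comp_contMDiffOn contMDiffOn_capArg
    have h2 : ContMDiffOn 𝓘(ℝ, 𝔼 2) 𝓘(ℝ, 𝔼 4) ∞ (capDisc f) {0}ᶜ :=
      contDiff_unitInversion.contMDiff.comp_contMDiffOn h1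
    exact contMDiffOn_iff_contDiffOn.1 h2
  refine ⟨?_, ?_, ?_, ?_, ?_⟩
  · -- `C^∞` everywhere
    rw [contDiff_iff_contDiffAt]
    intro y
    by_cases hy0 : y = 0
    · subst hy0
      have hev : capDisc f =ᶠ[𝓝 (0 : 𝔼 2)] flatDisc := by
        have hO : IsOpen {y : 𝔼 2 | ‖y‖ < 1 / (2 - δ)} := isOpen_lt continuous_norm continuous_const
        filter_upwards [hO.mem_nhds (show ‖(0 : 𝔼 2)‖ < 1 / (2 - δ) by
          rw [norm_zero]; positivity)] with y hy using hflat y hy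
      exact flatDisc.contDiff.contDiffAt.congr_of_eventuallyEq hev
    · exact hsmooth0.contDiffAt (isOpen_compl_singleton.mem_nhds hy0)
  · -- injectivity on `𝔻²`
    have hz : ∀ y : 𝔼 2, y ≠ 0 → ‖y‖ ≤ 1 → capDisc f y ≠ 0 := by
      intro y hy0 hy1 h
      have h1 := hnorm1 y hy0 hy1
      have := norm_unitInversion (z := f (capArg y)) (by linarith)
      rw [capDisc] at h
      rw [h, norm_zero] at this
      exact (inv_ne_zero (by linarith)) this.symm
    -- injectivity of `y ↦ f (capArg y)` on `𝔻² ∖ 0`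
    have hinjF : ∀ y y' : 𝔼 2, y ≠ 0 → ‖y‖ ≤ 1 → y' ≠ 0 → ‖y'‖ ≤ 1 →
        f (capArg y) = f (capArg y') → y = y' := by
      intro y y' hy0 hy1 hy0' hy1' h
      have hn : 0 < ‖y‖ := norm_pos_iff.2 hy0
      have hn' : 0 < ‖y'‖ := norm_pos_iff.2 hy0'
      rcases le_or_gt ‖y‖⁻¹ 2 with ht | ht <;> rcases le_or_gt ‖y'‖⁻¹ 2 with ht' | ht'
      · have hm : capArg y ∈ univ ×ˢ Icc (1 : ℝ) 2 :=
          ⟨mem_univ _, one_le_inv_iff₀.2 ⟨hn, hy1⟩, ht⟩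
        have hm' : capArg y' ∈ univ ×ˢ Icc (1 : ℝ) 2 :=
          ⟨mem_univ _, one_le_inv_iff₀.2 ⟨hn', hy1'⟩, ht'⟩
        exact capArg_injOn hy0 hy0' (hinj hm hm' h)
      · exfalso
        have h1 : ‖f (capArg y)‖ ≤ 2 := (hnorm (capArg y).1 ⟨one_le_inv_iff₀.2 ⟨hn, hy1⟩, ht⟩).2
        have h2 := norm_apply_capArg_of_le hhigh hy0' (by linarith)
        rw [h, h2] at h1
        linarith
      · exfalso
        have h1 : ‖f (capArg y')‖ ≤ 2 :=
          (hnorm (capArg y').1 ⟨one_le_inv_iff₀.2 ⟨hn', hy1'⟩, ht'⟩).2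
        have h2 := norm_apply_capArg_of_le hhigh hy0 (by linarith)
        rw [← h, h2] at h1
        linarith
      · rw [apply_capArg_of_le hhigh hy0 (by linarith), apply_capArg_of_le hhigh hy0' (by linarith),
          ← map_smul, ← map_smul] at h
        have h' := flatDisc_injective h
        have key : ∀ w : 𝔼 2, w ≠ 0 → ‖(‖w‖⁻¹ * ‖w‖⁻¹) • w‖ = ‖w‖⁻¹ := fun w hw ↦ by
          rw [norm_smul, Real.norm_of_nonneg (by positivity), mul_assoc,
            inv_mul_cancel₀ (norm_ne_zero_iff.2 hw), mul_one]
        have hnn : ‖y‖ = ‖y'‖ := by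
          have := congrArg (fun w ↦ ‖w‖) h'
          simp only [key y hy0, key y' hy0'] at this
          exact inv_injective this
        rw [hnn] at h'
        exact smul_right_injective (𝔼 2) (by positivity) h'
    intro y hy y' hy' h
    rw [mem_closedBall_zero_iff] at hy hy'
    by_cases hy0 : y = 0
    · subst hy0
      by_contra hne'
      refine hz y' (Ne.symm hne') hy' ?_
      rw [← h, capDisc, capArg_zero, hlow basePt 0 (by linarith), zero_smul, unitInversion_zero]
    by_cases hy0' : y' = 0
    · subst hy0'
      exfalso
      refine hz y hy0 hy ?_
      rw [h, capDisc, capArg_zero, hlow basePt 0 (by linarith), zero_smul, unitInversion_zero]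
    refine hinjF y y' hy0 hy hy0' hy' (unitInversion_injOn ?_ ?_ h)
    · exact show (1 : ℝ) / 2 ≤ ‖f (capArg y)‖ by linarith [hnorm1 y hy0 hy]
    · exact show (1 : ℝ) / 2 ≤ ‖f (capArg y')‖ by linarith [hnorm1 y' hy0' hy']
  · -- immersion on `𝔻²`
    intro y hy
    rw [mem_closedBall_zero_iff] at hy
    rcases lt_or_ge ‖y‖ (1 / (2 - δ)) with h | h
    · have hev : capDisc f =ᶠ[𝓝 y] flatDisc := by
        have hO : IsOpen {y : 𝔼 2 | ‖y‖ < 1 / (2 - δ)} := isOpen_lt continuous_norm continuous_const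
        filter_upwards [hO.mem_nhds h] with y' hy' using hflat y' hy'
      rw [hev.fderiv_eq, ContinuousLinearMap.fderiv]
      exact flatDisc_injective
    · have hy0 : y ≠ 0 := hne y h
      have ht := htime y h hy
      have hdA : MDifferentiableAt 𝓘(ℝ, 𝔼 2) ((𝓡 1).prod 𝓘(ℝ, ℝ)) capArg y :=
        (contMDiffAt_capArg hy0).mdifferentiableAt (by simp)
      have hdf : MDifferentiableAt ((𝓡 1).prod 𝓘(ℝ, ℝ)) 𝓘(ℝ, 𝔼 4) f (capArg y) :=
        hsmooth.mdifferentiableAt (by simp)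
      have hdU : MDifferentiableAt 𝓘(ℝ, 𝔼 4) 𝓘(ℝ, 𝔼 4) unitInversion ((f ∘ capArg) y) :=
        contDiff_unitInversion.contMDiff.mdifferentiableAt (by simp)
      have h1 : 1 ≤ ‖f (capArg y)‖ ∧ ‖f (capArg y)‖ ≤ 2 := hnorm (capArg y).1 ht
      rw [← mfderiv_eq_fderiv, show capDisc f = unitInversion ∘ (f ∘ capArg) from rfl,
        mfderiv_comp _ hdU (hdf.comp _ hdA), mfderiv_comp _ hdf hdA, mfderiv_eq_fderiv]
      exact (fderiv_unitInversion_injective h1.1 h1.2).comp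
        ((himm _ (hmemA y h hy)).comp (mfderiv_capArg_injective hy0))
  · -- the open disc goes into the open ball
    intro y hy
    rcases lt_or_ge ‖y‖ (1 / (2 - δ)) with h | h
    · rw [hflat y h, norm_flatDisc]
      calc ‖y‖ < 1 / (2 - δ) := h
        _ ≤ 1 := by rw [div_le_one h2δ]; linarith
    · have hy0 : y ≠ 0 := hne y h
      have hn : 0 < ‖y‖ := norm_pos_iff.2 hy0
      have ht1 : 1 < ‖y‖⁻¹ := one_lt_inv_iff₀.2 ⟨hn, hy⟩
      have ht2 : ‖y‖⁻¹ < 2 := by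
        rw [inv_lt_comm₀ hn two_pos]
        calc (2 : ℝ)⁻¹ < 1 / (2 - δ) := by
              rw [inv_eq_one_div, div_lt_div_iff_of_pos_left one_pos two_pos h2δ]; linarith
          _ ≤ ‖y‖ := h
      obtain ⟨hl, -⟩ := hshell (capArg y).1 ‖y‖⁻¹ ⟨ht1, ht2⟩
      have hl' : 1 < ‖f (capArg y)‖ := hl
      rw [capDisc, norm_unitInversion (by linarith)]
      exact inv_lt_one_of_one_lt₀ hl'
  · -- boundary values
    intro x
    rw [capDisc, capArg_coe_sphere, hK, unitInversion_of_norm_eq_one (norm_eq_of_mem_sphere _)]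

end CapOff

/-- **A knot concordant to the unknot is smoothly slice.** Take a concordance conical beyond
the seams (`IsConcordance.exists_conical`), cap off its trivial end by the flat disc — in the
inverted picture, `CapOff.capDisc` — to get a proper slice disc (`CapOff.isProperDisc_capDisc`),
and neaten it (`isSmoothlySlice_of_isProperDisc_holds`). Fox–Milnor (1966), §3: the class `<0>`
of slice knots is the identity of the knot cobordism group, with Thm. 3 (cobordism = annulus in
`S³ × I`); Livingston (2005), §1. [cite: FoxMilnor1966, §3 Thm. 3] -/
theorem IsConcordant.isSmoothlySlice_of_unknot [SphereEmbedding.SmoothnessFacts] {K : Knot}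
    (h : K.IsConcordant unknot) : K.IsSmoothlySlice := by
  obtain ⟨f, hf⟩ := h
  obtain ⟨f₂, hf₂, δ, hδ, hδ4, hlow, hhigh⟩ := hf.exists_conical
  exact isSmoothlySlice_of_isProperDisc_holds K _ (CapOff.isProperDisc_capDisc hf₂ hδ hδ4 hlow hhigh)

end Knot

end Literature.Topology.FourManifolds
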